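import Mathlib
import HarnessLib
import Summits.KontsevichZagierPeriods.Zeta5Search.VWPStepCore

/-!
# ζ(5) search — the corrected induction step for Zudilin's theorem in `h`-coordinates (cell `pub-zeta5`, ct-1 g28)

HONEST FRAMING: systematic search; no irrationality claim unless kernel-certified.  Bookkeeping (finite products, reindexing) around the
analytic core `VWPStepCore.step_core`; nothing here is an irrationality result, a worthiness exponent or a denominator statement; no
named fact is discharged; no definition is introduced.

Brick B6c (fourth part) of `HOME/ct-1/g28/VWP-BLUEPRINT-g28.md` §3.  Write `S(n)(g)` for Zudilin's identity (4) with `n` integration variables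
at complex parameters `g : ℕ → ℂ` (inline: `[∏_{i∈Icc 1 (n+1)}Γ(1+g₀−g_i−g_{i+1})]/(Γ(g₁)Γ(g_{n+2})) · Σ_μ (g₀+2μ)∏_{i<n+3}Γ(g_i+μ)/Γ(1+g₀−g_i+μ)
(−1)^{(n+3)μ} = J_n(g₁; g_{j+2} | 1+g₀−g_{j+3})`, the shapes of the typed `vwp_eq_integral_of_pos`).  Then:

  **`step`**: if `S(k)(g)` holds for every `y : ℝ` and every `g` with `g₀ = h₀`, `g₁ = −s` (`s = −t₀+iy`), `g_i = h_{i+1}` (`i ≥ 2`), and the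
  analytic side conditions of `step_core` hold at `a₀ = h₁`, `a_j = h_{j+2}`, `b_j = 1+h₀−h_{j+3}`, `c = 1+h₀` (h₀ real), then `S(k+1)(h)`.

The work is: (i) the inductive prefactor at `g` is `Γ(1+h₀−h₃+s)·∏_{i∈Icc 2 (k+1)}Γ(1+h₀−h_{i+1}−h_{i+2})/(Γ(−s)Γ(h_{k+3}))` and the `F_{k+2}(g)`
term splits off its `i = 1` factor `Γ(μ−s)/Γ(1+h₀+μ+s)` (`prod_erase_one`), so `S(k)(g)` is `step_core`'s abstract hypothesis with explicit
`R`, `D_μ`; (ii) `step_core`'s conclusion resums to `P_{k+1}(h)·F_{k+3}(h)` (`prod_Icc_one`, `prod_range_split`).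

Theorems only; imports `Zeta5Search/VWPStepCore`.
-/

noncomputable section

namespace Summit.KontsevichZagierPeriods.Zeta5Search.VWPStepAlgebra

open MeasureTheory Set Filter
open scoped Real
open Literature.NumberTheory.Irrationality.Zudilin2002 (nestedQ sorokinIntegrand)
open Summit.KontsevichZagierPeriods.Zeta5Search.VWPStepCore (step_core)

variable {t₀ : ℝ} {h : ℕ → ℂ}

/-! ### 1. Finite-product bookkeeping -/

/-- Splitting the `i = 1` factor off the `F_{k+2}` product at shifted parameters `g` (`g₀ = h₀`, `g_i = h_{i+1}` for `i ≥ 2`):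
`∏_{i<k+3} Φ(g_i) = Φ(g₁) · (Φ(h₀) · ∏_{i∈Icc 3 (k+3)} Φ(h_i))`. -/
theorem prod_erase_one (k : ℕ) (Φ : ℂ → ℂ) {g h : ℕ → ℂ} (hg0 : g 0 = h 0) (hg : ∀ i, 2 ≤ i → g i = h (i + 1)) :
    ∏ i ∈ Finset.range (k + 3), Φ (g i) = Φ (g 1) * (Φ (h 0) * ∏ i ∈ Finset.Icc 3 (k + 3), Φ (h i)) := by
  rw [← Finset.mul_prod_erase (Finset.range (k + 3)) (fun i => Φ (g i)) (a := 1) (by simp)]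
  congr 1
  have hset : (Finset.range (k + 3)).erase 1 = insert 0 (Finset.Icc 2 (k + 2)) := by ext i; simp; omega
  rw [hset, Finset.prod_insert (by simp), hg0]
  congr 1
  rw [show Finset.Icc 3 (k + 3) = Finset.Icc (2 + 1) (k + 2 + 1) by rfl, ← Finset.map_add_right_Icc, Finset.prod_map]
  refine Finset.prod_congr rfl fun i hi => ?_
  have hi2 : 2 ≤ i := (Finset.mem_Icc.1 hi).1
  rw [hg i hi2]
  rfl

/-- The inductive prefactor at `g`: `∏_{i∈Icc 1 (k+1)} Γ(1+g₀−g_i−g_{i+1}) = Γ(1+h₀−g₁−h₃) · ∏_{i∈Icc 2 (k+1)} Γ(1+h₀−h_{i+1}−h_{i+2})` (`k ≥ 1`). -/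
theorem prod_Icc_shifted {k : ℕ} (hk : 1 ≤ k) {g h : ℕ → ℂ} (hg0 : g 0 = h 0) (hg : ∀ i, 2 ≤ i → g i = h (i + 1)) :
    ∏ i ∈ Finset.Icc 1 (k + 1), Complex.Gamma (1 + g 0 - g i - g (i + 1)) =
      Complex.Gamma (1 + h 0 - g 1 - h 3) * ∏ i ∈ Finset.Icc 2 (k + 1), Complex.Gamma (1 + h 0 - h (i + 1) - h (i + 2)) := by
  have hset : Finset.Icc 1 (k + 1) = insert 1 (Finset.Icc 2 (k + 1)) := by ext i; simp; omega
  rw [hset, Finset.prod_insert (by simp), hg0, hg 2 le_rfl]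
  congr 1
  refine Finset.prod_congr rfl fun i hi => ?_
  have hi2 : 2 ≤ i := (Finset.mem_Icc.1 hi).1
  rw [hg i hi2, hg (i + 1) (by omega)]

/-- The new prefactor: `∏_{i∈Icc 1 (k+2)} Γ(1+h₀−h_i−h_{i+1}) = Γ(1+h₀−h₁−h₂) · Γ(1+h₀−h₂−h₃) · ∏_{i∈Icc 2 (k+1)} Γ(1+h₀−h_{i+1}−h_{i+2})`
(`k ≥ 1`). -/
theorem prod_Icc_one {k : ℕ} (hk : 1 ≤ k) (h : ℕ → ℂ) :
    ∏ i ∈ Finset.Icc 1 (k + 2), Complex.Gamma (1 + h 0 - h i - h (i + 1)) =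
      Complex.Gamma (1 + h 0 - h 1 - h 2) * (Complex.Gamma (1 + h 0 - h 2 - h 3) *
        ∏ i ∈ Finset.Icc 2 (k + 1), Complex.Gamma (1 + h 0 - h (i + 1) - h (i + 2))) := by
  have hset : Finset.Icc 1 (k + 2) = insert (1 : ℕ) (insert (2 : ℕ) (Finset.Icc 3 (k + 2))) := by ext i; simp; omega
  rw [hset, Finset.prod_insert (by simp), Finset.prod_insert (by simp)]
  congr 2
  rw [show Finset.Icc 3 (k + 2) = Finset.Icc (2 + 1) (k + 1 + 1) by rfl, ← Finset.map_add_right_Icc, Finset.prod_map]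
  rfl

/-- The new series term: `∏_{i<k+4} Φ(h_i) = Φ(h₀)Φ(h₁)Φ(h₂) · ∏_{i∈Icc 3 (k+3)} Φ(h_i)`. -/
theorem prod_range_split (k : ℕ) (Φ : ℂ → ℂ) (h : ℕ → ℂ) :
    ∏ i ∈ Finset.range (k + 4), Φ (h i) = Φ (h 0) * Φ (h 1) * Φ (h 2) * ∏ i ∈ Finset.Icc 3 (k + 3), Φ (h i) := by
  have hset : Finset.range (k + 4) = insert (0 : ℕ) (insert (1 : ℕ) (insert (2 : ℕ) (Finset.Icc 3 (k + 3)))) := by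
    ext i; simp; omega
  rw [hset, Finset.prod_insert (by simp), Finset.prod_insert (by simp), Finset.prod_insert (by simp)]
  ring

/-! ### 2. The step in `h`-coordinates -/

/-- **The induction step `S(k) ⇒ S(k+1)` on the sub-region, in `h`-coordinates** (corrected first-variable route; `k ≥ 1`, `h₀` real).
Hypotheses: `0 < t₀ < Re h₁`, `t₀ < Re h₂`, the cut condition (C) `Re h₁ + Re h₂ < Re(1+h₀−h₃)`, `Re h₁ + Re h₂ < 1+h₀`,
`t₀ ≤ h₀`, `ε = ±1`, `θ ≥ 0` with `Re h₁ + Re h₂ − 2t₀ < (1+h₀−2t₀)(1−θ)`, integrability of the `J_{k+1}`-integrand and of the typed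
`J_k`-integrand at `(t₀; Re h_{j+3} | Re(1+h₀−h_{j+4}))`, the summability `Σ_μ ‖D_μ‖(1+h₀−t₀+μ)^{−(1+h₀−2t₀)θ} < ∞` of
`D_μ = (h₀+2μ)[Γ(h₀+μ)/Γ(1+μ)]∏_{i∈Icc 3 (k+3)}[Γ(h_i+μ)/Γ(1+h₀−h_i+μ)](−1)^{(k+3)μ}` (condition (J)), and the INDUCTIVE HYPOTHESIS
`S(k)(g)` for every `y` and every `g` with `g₀ = h₀`, `g₁ = −s`, `g_i = h_{i+1}` (`i ≥ 2`).  Conclusion: `S(k+1)(h)`. -/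
theorem step {k : ℕ} (hk : 1 ≤ k) (h : ℕ → ℂ) (hreal : (h 0).im = 0) (ht₀ : 0 < t₀) (h1 : t₀ < (h 1).re) (h2 : t₀ < (h 2).re)
    (hC : (h 1).re + (h 2).re < (1 + h 0 - h 3).re) (h12 : (h 1).re + (h 2).re < 1 + (h 0).re)
    (hc1 : t₀ ≤ (h 0).re) {ε : ℝ} (hε : ε = 1 ∨ ε = -1) {θ : ℝ} (hθ0 : 0 ≤ θ)
    (hq : (h 1).re + (h 2).re - 2 * t₀ < (1 + (h 0).re - 2 * t₀) * (1 - θ))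
    (hF : IntegrableOn (fun x : Fin (k + 1) → ℝ =>
      (∏ j : Fin (k + 1), ((x j : ℝ) : ℂ) ^ (h (j + 2) - 1) * (1 - ((x j : ℝ) : ℂ)) ^ ((1 + h 0 - h (j + 3)) - h (j + 2) - 1)) *
        ((nestedQ (List.ofFn x) : ℝ) : ℂ) ^ (-h 1)) (Set.pi univ fun _ : Fin (k + 1) => Icc (0 : ℝ) 1) volume)
    (hJ : IntegrableOn (sorokinIntegrand k t₀ (fun n => (h (n + 1 + 2)).re) (fun n => (1 + h 0 - h (n + 1 + 3)).re))
      (Set.pi univ fun _ : Fin k => Icc (0 : ℝ) 1) volume)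
    (hD : Summable fun μ : ℕ => ‖(h 0 + 2 * (μ : ℂ)) * (Complex.Gamma (h 0 + μ) / Complex.Gamma (1 + h 0 - h 0 + μ) *
        ∏ i ∈ Finset.Icc 3 (k + 3), Complex.Gamma (h i + μ) / Complex.Gamma (1 + h 0 - h i + μ)) * (-1 : ℂ) ^ ((k + 3) * μ)‖ *
        (1 + (h 0).re - t₀ + μ) ^ (-((1 + (h 0).re - 2 * t₀) * θ)))
    (IH : ∀ (y : ℝ) (g : ℕ → ℂ), g 0 = h 0 → g 1 = -(-(t₀ : ℂ) + (y : ℂ) * Complex.I) → (∀ i, 2 ≤ i → g i = h (i + 1)) →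
      (∏ i ∈ Finset.Icc 1 (k + 1), Complex.Gamma (1 + g 0 - g i - g (i + 1))) / (Complex.Gamma (g 1) * Complex.Gamma (g (k + 2))) *
          (∑' μ : ℕ, (g 0 + 2 * (μ : ℂ)) * (∏ i ∈ Finset.range (k + 3), Complex.Gamma (g i + μ) / Complex.Gamma (1 + g 0 - g i + μ)) *
            (-1 : ℂ) ^ ((k + 3) * μ)) =
        ∫ x in Set.pi univ (fun _ : Fin k => Icc (0 : ℝ) 1),
          (∏ j : Fin k, ((x j : ℝ) : ℂ) ^ (g (j + 2) - 1) * (1 - ((x j : ℝ) : ℂ)) ^ ((1 + g 0 - g (j + 3)) - g (j + 2) - 1)) *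
            ((nestedQ (List.ofFn x) : ℝ) : ℂ) ^ (-g 1)) :
    (∏ i ∈ Finset.Icc 1 (k + 2), Complex.Gamma (1 + h 0 - h i - h (i + 1))) / (Complex.Gamma (h 1) * Complex.Gamma (h (k + 3))) *
        (∑' μ : ℕ, (h 0 + 2 * (μ : ℂ)) * (∏ i ∈ Finset.range (k + 4), Complex.Gamma (h i + μ) / Complex.Gamma (1 + h 0 - h i + μ)) *
          (-1 : ℂ) ^ ((k + 4) * μ)) =
      ∫ x in Set.pi univ (fun _ : Fin (k + 1) => Icc (0 : ℝ) 1),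
        (∏ j : Fin (k + 1), ((x j : ℝ) : ℂ) ^ (h (j + 2) - 1) * (1 - ((x j : ℝ) : ℂ)) ^ ((1 + h 0 - h (j + 3)) - h (j + 2) - 1)) *
          ((nestedQ (List.ofFn x) : ℝ) : ℂ) ^ (-h 1) := by
  -- the real `c = 1 + h₀`
  set c : ℝ := 1 + (h 0).re with hcdef
  have hh0 : ((h 0).re : ℂ) = h 0 := by
    apply Complex.ext <;> simp [hreal]
  have hcC : (c : ℂ) = 1 + h 0 := by rw [hcdef]; push_cast; rw [hh0]
  -- the constants of the abstract inductive hypothesis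
  set R : ℂ := (∏ i ∈ Finset.Icc 2 (k + 1), Complex.Gamma (1 + h 0 - h (i + 1) - h (i + 2))) / Complex.Gamma (h (k + 3)) with hR
  set D : ℕ → ℂ := fun μ => (h 0 + 2 * (μ : ℂ)) * (Complex.Gamma (h 0 + μ) / Complex.Gamma (1 + h 0 - h 0 + μ) *
      ∏ i ∈ Finset.Icc 3 (k + 3), Complex.Gamma (h i + μ) / Complex.Gamma (1 + h 0 - h i + μ)) * (-1 : ℂ) ^ ((k + 3) * μ) with hDdef
  -- (i) the inductive hypothesis in `step_core`'s shape
  have IH' : ∀ y : ℝ,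
      ∫ x' in Set.pi univ (fun _ : Fin k => Icc (0 : ℝ) 1),
          (∏ j : Fin k, ((x' j : ℝ) : ℂ) ^ ((fun n => h (n + 2)) (j + 1) - 1) *
              (1 - ((x' j : ℝ) : ℂ)) ^ ((fun n => 1 + h 0 - h (n + 3)) (j + 1) - (fun n => h (n + 2)) (j + 1) - 1)) *
            ((nestedQ (List.ofFn x') : ℝ) : ℂ) ^ (-(-(-(t₀ : ℂ) + (y : ℂ) * Complex.I))) =
        Complex.Gamma ((fun n => 1 + h 0 - h (n + 3)) 0 + (-(t₀ : ℂ) + (y : ℂ) * Complex.I)) /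
            Complex.Gamma (-(-(t₀ : ℂ) + (y : ℂ) * Complex.I)) * R *
          ∑' μ : ℕ, D μ * (Complex.Gamma ((μ : ℂ) - (-(t₀ : ℂ) + (y : ℂ) * Complex.I)) /
            Complex.Gamma ((c : ℂ) + μ + (-(t₀ : ℂ) + (y : ℂ) * Complex.I))) := by
    intro y
    set s : ℂ := -(t₀ : ℂ) + (y : ℂ) * Complex.I with hs
    set g : ℕ → ℂ := fun i => if i = 0 then h 0 else if i = 1 then -s else h (i + 1) with hgdef
    have hg0 : g 0 = h 0 := by simp [hgdef]
    have hg1 : g 1 = -s := by simp [hgdef]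
    have hg : ∀ i, 2 ≤ i → g i = h (i + 1) := fun i hi => by
      simp [hgdef, show i ≠ 0 by omega, show i ≠ 1 by omega]
    have hI := IH y g hg0 hg1 hg
    -- the integrand of `S(k)(g)` is the one of `step_core`
    have hint : (fun x : Fin k → ℝ =>
        (∏ j : Fin k, ((x j : ℝ) : ℂ) ^ (g (j + 2) - 1) * (1 - ((x j : ℝ) : ℂ)) ^ ((1 + g 0 - g (j + 3)) - g (j + 2) - 1)) *
          ((nestedQ (List.ofFn x) : ℝ) : ℂ) ^ (-g 1)) =
        fun x' => (∏ j : Fin k, ((x' j : ℝ) : ℂ) ^ ((fun n => h (n + 2)) (j + 1) - 1) *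
              (1 - ((x' j : ℝ) : ℂ)) ^ ((fun n => 1 + h 0 - h (n + 3)) (j + 1) - (fun n => h (n + 2)) (j + 1) - 1)) *
            ((nestedQ (List.ofFn x') : ℝ) : ℂ) ^ (-(-s)) := by
      funext x
      rw [hg1]
      congr 1
    rw [hint] at hI
    rw [← hI, prod_Icc_shifted hk hg0 hg, hg1, hg (k + 2) (by omega)]
    simp only [hg0]
    -- the series: split off `i = 1`
    have hser : ∀ μ : ℕ, (h 0 + 2 * (μ : ℂ)) * (∏ i ∈ Finset.range (k + 3), Complex.Gamma (g i + μ) / Complex.Gamma (1 + h 0 - g i + μ)) *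
          (-1 : ℂ) ^ ((k + 3) * μ) =
        D μ * (Complex.Gamma ((μ : ℂ) - s) / Complex.Gamma ((c : ℂ) + μ + s)) := by
      intro μ
      rw [prod_erase_one k (fun u => Complex.Gamma (u + μ) / Complex.Gamma (1 + h 0 - u + μ)) hg0 hg, hg1, hcC]
      simp only [hDdef]
      rw [show -s + (μ : ℂ) = μ - s by ring, show 1 + h 0 - -s + μ = 1 + h 0 + μ + s by ring]
      ring
    simp_rw [hser]
    simp only [zero_add]
    rw [show (k : ℕ) + 2 + 1 = k + 3 by ring, show 1 + h 0 - h 3 + s = 1 + h 0 - -s - h 3 by ring, hR]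
    ring
  -- (ii) apply the analytic core
  have hb : (h 1).re + ((fun n : ℕ => h (n + 2)) 0).re < ((fun n : ℕ => 1 + h 0 - h (n + 3)) 0).re := by simpa using hC
  have core := step_core (a₀ := h 1) (a := fun n => h (n + 2)) (b := fun n => 1 + h 0 - h (n + 3)) hk ht₀ h1
    (by simpa using h2) hb (c := c) (by rw [hcdef]; simpa using h12) (by rw [hcdef]; linarith) (by rw [hcdef]; linarith) hε hθ0
    (by rw [hcdef]; simpa using hq) hF hJ R D (by rw [hcdef]; simpa [hDdef] using hD) IH'
  rw [core]
  -- (iii) resum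
  rw [prod_Icc_one hk h, hR, ← tsum_mul_left, ← tsum_mul_left]
  refine tsum_congr fun μ => ?_
  rw [prod_range_split k (fun u => Complex.Gamma (u + μ) / Complex.Gamma (1 + h 0 - u + μ)) h, hDdef, hcC]
  simp only [zero_add]
  rw [show 1 + h 0 - h 3 - h 2 = 1 + h 0 - h 2 - h 3 by ring, show (k + 4) * μ = (k + 3) * μ + μ by ring, pow_add]
  ring

end Summit.KontsevichZagierPeriods.Zeta5Search.VWPStepAlgebra

end
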